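import Literature.Analysis.FluidPDE.TorusClassicalH1Balance
import Mathlib.Analysis.SpecialFunctions.Pow.Real
import Mathlib.Analysis.SpecialFunctions.Sqrt
import Mathlib.Analysis.Calculus.MeanValue
import HarnessLib

/-!
# Explicit enstrophy-growth bounds for Navier–Stokes on the unit 3-torus (Lu–Doering 2008; Ayala–Protas 2017)

Analysis/FluidPDE file: one NAMED FACT and its PROVED integrated consequences — the a-priori side
of the "extreme enstrophy growth" programme (Lu–Doering 2008; Ayala–Protas 2017, §2;
Kang–Yun–Protas 2020, §2), with the explicit constants these papers print.

Setting = theirs: the incompressible Navier–Stokes system WITHOUT forcing on the unit periodic box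
`Ω = [0,1]³`, i.e. classical solutions `Torus.IsClassicalNSSolutionOn (Icc a b) ν 0 u p` on
`UnitAddTorus d`, `Fintype.card d = 3`, with kinetic energy `K = Torus.kineticEnergy = ½∫|u|²`
and ENSTROPHY `ℰ = ½∫|∇u|² = torusEnstrophy` (Ayala–Protas 2017, (2.3)–(2.4): `∫|∇×u|² = ∫|∇u|²`
for periodic divergence-free fields, so `ℰ = ½‖∇u‖₂²`; no factor conventions differ from theirs).

* `luDoeringConst ν = 27/(8π⁴ν³)` — the constant of the sharp instantaneous estimate
  `dℰ/dt ≤ 27/(8π⁴ν³) ℰ³` (Lu–Doering 2008, main estimate; Ayala–Protas 2017, (2.7));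
* `LuDoering2008_enstrophyRate_le` — that estimate as a NAMED FACT (its proof is 3D
  Sobolev/interpolation analysis not in the tree): along every zero-mean classical solution on
  `[a, b]`, `a < b`, the one-sided derivative of `t ↦ ℰ(u(t))` within `[a, b]` is
  `≤ luDoeringConst ν · ℰ(u(t))³`;
* PROVED from the fact by ODE comparison (`le_div_sqrt_of_hasDerivWithinAt_le_cube`, a
  real-variable lemma: `y' ≤ A y³`, `y > 0` ⇒ `y(t) ≤ y(a)/√(1 − 2A y(a)²(t − a))`):
  `torusEnstrophy_le_luDoeringMajorant` — Ayala–Protas (2.8), `ℰ(t) ≤ ℰ(a)/√(1 − (27/(4π⁴ν³)) ℰ(a)² (t−a))`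
  while the root is positive, i.e. for `t − a < t₀ = 4π⁴ν³/(27 ℰ(a)²) = luDoeringBlowupTime`;
* PROVED from the fact and the tree's energy balance
  (`Torus.IsClassicalNSSolutionOn.energy_balance_holds`, `dK/dt = −ν‖∇u‖² = −2νℰ`):
  `inv_torusEnstrophy_sub_inv_le` — Ayala–Protas (2.10),
  `1/ℰ(a) − 1/ℰ(t) ≤ (27/(2πν)⁴)(K(a) − K(t))`, and `torusEnstrophy_le_of_small` — (2.11)–(2.12):
  if `27 K(a)ℰ(a)/(2πν)⁴ < 1` then `ℰ(t) ≤ ℰ(a)/(1 − 27 K(a)ℰ(a)/(2πν)⁴)` for all later `t`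
  ("small data": `K(a)ℰ(a) < (2πν)⁴/27 = luDoeringSmallDataThreshold ν`).
* Closed forms: `luDoeringBlowupTime_eq`, `luDoeringSmallDataThreshold_eq`,
  `luDoeringConst_div_two_nu` (`C/(2ν) = 27/(2πν)⁴`).

Design choices. The derivative of the enstrophy is the ONE-SIDED derivative within `[a, b]`
(the tree's convention, `Torus.IsClassicalNSSolutionOn.hasDerivWithinAt_half_gradNormSq`); the
fact is stated as "every `HasDerivWithinAt` value `R` satisfies `R ≤ Cℰ³`" and requires `a < b`
(on a singleton every `R` is a derivative). Zero mean `∀ t, Torus.HasZeroMean (u t)` is Lu–Doering's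
class (the estimate is Galilean-invariant anyway). Positivity `0 < ℰ(u t)` on the window is an
explicit hypothesis of the corollaries (they divide by `ℰ`); for zero-mean data `ℰ = 0` is the rest
state. Junk values: `luDoeringMajorant ν E₀ t = E₀/√(…)` is `E₀/0 = 0` past `t₀` (`Real.sqrt` of a
negative number is `0`); the theorems only use it before `t₀`.

Deliberately NOT here: the proof of the instantaneous estimate and its sharpness / maximisers
(Lu–Doering 2008, numerics), the `K`-dependent form `dℰ/dt ≤ −νℰ²/K + cℰ³/ν³` (Ayala–Protas
(2.6), constant unspecified), whole-space versions (`LerayEnstrophyAPriori.lean` has the `ℝ³`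
cubic inequality with an unspecified constant), Euler / Beale–Kato–Majda, the `L^q` (Leray-scaling)
analogues, and every statement about how much growth is ACHIEVED (open; route statements, cf.
`MaximalEnstrophy.lean`).
-/

noncomputable section

open MeasureTheory Set Function
open scoped InnerProductSpace RealInnerProductSpace

namespace Literature.Analysis.FluidPDE

open Literature.Analysis.FunctionSpaces

/-! ## The constants -/

section Constants

/-- The Lu–Doering constant `C_LD(ν) = 27/(8π⁴ν³)` of the sharp instantaneous enstrophy estimate
`dℰ/dt ≤ C_LD(ν) ℰ³` for zero-mean Navier–Stokes flows on the unit 3-torus (Lu–Doering 2008, main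
estimate; as printed in Ayala–Protas 2017, eq. (2.7)). [cite: AyalaProtas2017, eq. (2.7)] -/
def luDoeringConst (ν : ℝ) : ℝ :=
  27 / (8 * Real.pi ^ 4 * ν ^ 3)

/-- The blow-up time `t₀ = 1/(2 C_LD ℰ₀²)` of the integrated majorant `ℰ₀/√(1 − 2C_LD ℰ₀² t)`;
in closed form `t₀ = 4π⁴ν³/(27 ℰ₀²)` (`luDoeringBlowupTime_eq`; Ayala–Protas 2017, after
eq. (2.8)). Junk value `1/0 = 0` when `ν = 0` or `ℰ₀ = 0`. [cite: AyalaProtas2017, §2 after eq. (2.8)] -/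
def luDoeringBlowupTime (ν E₀ : ℝ) : ℝ :=
  1 / (2 * luDoeringConst ν * E₀ ^ 2)

/-- The integrated majorant `ℰ₀ / √(1 − 2 C_LD(ν) ℰ₀² t) = ℰ₀/√(1 − (27/(4π⁴ν³)) ℰ₀² t)` of
Ayala–Protas 2017, eq. (2.8) (obtained by integrating `dℰ/dt ≤ C_LD ℰ³`). Junk value `ℰ₀/0 = 0`
for `t ≥ t₀` (`Real.sqrt` vanishes on nonpositive reals). [cite: AyalaProtas2017, eq. (2.8)] -/
def luDoeringMajorant (ν E₀ t : ℝ) : ℝ :=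
  E₀ / Real.sqrt (1 - 2 * luDoeringConst ν * E₀ ^ 2 * t)

/-- The small-data threshold `(2πν)⁴/27`: if `K(0)ℰ(0)` is below it, the enstrophy stays bounded
for all times by `ℰ(0)/(1 − 27K(0)ℰ(0)/(2πν)⁴)` (Ayala–Protas 2017, eqs. (2.11)–(2.12), after
Lu–Doering 2008). [cite: AyalaProtas2017, eq. (2.12)] -/
def luDoeringSmallDataThreshold (ν : ℝ) : ℝ :=
  (2 * Real.pi * ν) ^ 4 / 27

/-- `C_LD(ν) > 0` for `ν > 0`. [cite: AyalaProtas2017, eq. (2.7)] -/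
theorem luDoeringConst_pos {ν : ℝ} (hν : 0 < ν) : 0 < luDoeringConst ν := by
  unfold luDoeringConst
  positivity

/-- Closed form of the blow-up time of the bound: `t₀ = 4π⁴ν³/(27ℰ₀²)` (Ayala–Protas 2017, after
eq. (2.8)). [cite: AyalaProtas2017, §2 after eq. (2.8)] -/
theorem luDoeringBlowupTime_eq {ν E₀ : ℝ} (hν : ν ≠ 0) (hE : E₀ ≠ 0) :
    luDoeringBlowupTime ν E₀ = 4 * Real.pi ^ 4 * ν ^ 3 / (27 * E₀ ^ 2) := by
  unfold luDoeringBlowupTime luDoeringConst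
  have hπ : Real.pi ≠ 0 := Real.pi_ne_zero
  field_simp
  ring

/-- `2 C_LD(ν) = 27/(4π⁴ν³)`, the coefficient under the root in Ayala–Protas 2017, eq. (2.8).
[cite: AyalaProtas2017, eq. (2.8)] -/
theorem two_mul_luDoeringConst {ν : ℝ} (hν : ν ≠ 0) :
    2 * luDoeringConst ν = 27 / (4 * Real.pi ^ 4 * ν ^ 3) := by
  unfold luDoeringConst
  have hπ : Real.pi ≠ 0 := Real.pi_ne_zero
  field_simp
  ring

/-- `C_LD(ν)/(2ν) = 27/(2πν)⁴`, the constant of Ayala–Protas 2017, eq. (2.10).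
[cite: AyalaProtas2017, eq. (2.10)] -/
theorem luDoeringConst_div_two_nu {ν : ℝ} (hν : ν ≠ 0) :
    luDoeringConst ν / (2 * ν) = 27 / (2 * Real.pi * ν) ^ 4 := by
  unfold luDoeringConst
  have hπ : Real.pi ≠ 0 := Real.pi_ne_zero
  field_simp
  ring

/-- The small-data threshold is `2ν/C_LD(ν)`. [cite: AyalaProtas2017, eq. (2.12)] -/
theorem luDoeringSmallDataThreshold_eq {ν : ℝ} (hν : ν ≠ 0) :
    luDoeringSmallDataThreshold ν = 2 * ν / luDoeringConst ν := by
  unfold luDoeringSmallDataThreshold luDoeringConst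
  have hπ : Real.pi ≠ 0 := Real.pi_ne_zero
  field_simp
  ring

/-- At `t = 0` the majorant is the initial enstrophy. [cite: AyalaProtas2017, eq. (2.8)] -/
theorem luDoeringMajorant_zero (ν E₀ : ℝ) : luDoeringMajorant ν E₀ 0 = E₀ := by
  simp [luDoeringMajorant]

end Constants

/-! ## ODE comparison for `y' ≤ A y³` -/

section Comparison

/-- **Comparison lemma for the cubic differential inequality.** If `f > 0` on `[a, b]`, `a < b`,
has one-sided derivatives `f'` within `[a, b]` with `f' ≤ A f³`, then for every
`t ∈ [a, b]` with `2A f(a)² (t − a) < 1`,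
`f(t) ≤ f(a) / √(1 − 2A f(a)² (t − a))`
(the function `1/f² + 2A(t − a)` is nondecreasing). This is the integration step
"(2.7) ⇒ (2.8)" of Ayala–Protas 2017. [folklore] -/
theorem le_div_sqrt_of_hasDerivWithinAt_le_cube {f f' : ℝ → ℝ} {a b A : ℝ} (hab : a < b)
    (hf : ∀ t ∈ Icc a b, HasDerivWithinAt f (f' t) (Icc a b) t)
    (hpos : ∀ t ∈ Icc a b, 0 < f t) (hle : ∀ t ∈ Icc a b, f' t ≤ A * f t ^ 3) {t : ℝ}
    (ht : t ∈ Icc a b) (hsmall : 2 * A * f a ^ 2 * (t - a) < 1) :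
    f t ≤ f a / Real.sqrt (1 - 2 * A * f a ^ 2 * (t - a)) := by
  have ha : a ∈ Icc a b := left_mem_Icc.2 hab.le
  -- `g = 1/f² + 2A(· − a)` and its derivative within `[a, b]`
  set g : ℝ → ℝ := fun s => (f s ^ 2)⁻¹ + 2 * A * (s - a) with hg
  have hg' : ∀ s ∈ Icc a b,
      HasDerivWithinAt g (-(2 * f s * f' s) / (f s ^ 2) ^ 2 + 2 * A) (Icc a b) s := by
    intro s hs
    have h1 : HasDerivWithinAt (fun r => f r ^ 2) (2 * f s * f' s) (Icc a b) s :=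
      ((hf s hs).pow 2).congr_deriv (by norm_num)
    have h2 : HasDerivWithinAt (fun r => (f r ^ 2)⁻¹) (-(2 * f s * f' s) / (f s ^ 2) ^ 2)
        (Icc a b) s := h1.inv (pow_ne_zero 2 (hpos s hs).ne')
    have h3 : HasDerivWithinAt (fun r => 2 * A * (r - a)) (2 * A) (Icc a b) s := by
      simpa using ((hasDerivWithinAt_id s (Icc a b)).sub_const a).const_mul (2 * A)
    exact h2.add h3
  -- `g` is nondecreasing on `[a, b]`
  have hmono : MonotoneOn g (Icc a b) := by
    refine monotoneOn_of_hasDerivWithinAt_nonneg (convex_Icc a b)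
      (fun s hs => (hg' s hs).continuousWithinAt)
      (fun s hs => (hg' s (interior_subset hs)).mono interior_subset) fun s hs => ?_
    rw [interior_Icc] at hs
    have hs' : s ∈ Icc a b := Ioo_subset_Icc_self hs
    have hfs : 0 < f s := hpos s hs'
    have hprod : 2 * f s * f' s ≤ 2 * f s * (A * f s ^ 3) :=
      mul_le_mul_of_nonneg_left (hle s hs') (by positivity)
    have hdiv : 2 * f s * f' s / (f s ^ 2) ^ 2 ≤ 2 * A := by
      rw [div_le_iff₀ (by positivity)]
      nlinarith [hprod]
    have hneg : -(2 * f s * f' s) / (f s ^ 2) ^ 2 = -(2 * f s * f' s / (f s ^ 2) ^ 2) :=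
      neg_div _ _
    linarith [hneg]
  -- compare the endpoints
  have hcmp : g a ≤ g t := hmono ha ht ht.1
  simp only [hg, sub_self, mul_zero, add_zero] at hcmp
  have hfa : 0 < f a := hpos a ha
  have hft : 0 < f t := hpos t ht
  have hfa2 : 0 < f a ^ 2 := pow_pos hfa 2
  have hft2 : 0 < f t ^ 2 := pow_pos hft 2
  set D : ℝ := 1 - 2 * A * f a ^ 2 * (t - a) with hD
  have hD0 : 0 < D := by linarith
  -- `f(t)² · D ≤ f(a)²`
  have hkey : f t ^ 2 * D ≤ f a ^ 2 := by
    have h3 := mul_le_mul_of_nonneg_right hcmp (le_of_lt (mul_pos hfa2 hft2))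
    have e1 : (f a ^ 2)⁻¹ * (f a ^ 2 * f t ^ 2) = f t ^ 2 := by
      field_simp
    have e2 : ((f t ^ 2)⁻¹ + 2 * A * (t - a)) * (f a ^ 2 * f t ^ 2) =
        f a ^ 2 + 2 * A * (t - a) * (f a ^ 2 * f t ^ 2) := by
      field_simp
    rw [e1, e2] at h3
    rw [hD]
    nlinarith [h3]
  have hq : f t ^ 2 ≤ f a ^ 2 / D := by
    rw [le_div_iff₀ hD0]
    exact hkey
  calc f t = Real.sqrt (f t ^ 2) := (Real.sqrt_sq hft.le).symm
    _ ≤ Real.sqrt (f a ^ 2 / D) := Real.sqrt_le_sqrt hq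
    _ = f a / Real.sqrt D := by rw [Real.sqrt_div (sq_nonneg (f a)) D, Real.sqrt_sq hfa.le]

end Comparison

/-! ## Enstrophy on the torus and the Lu–Doering estimate -/

section Torus

variable {d : Type*} [Fintype d] [DecidableEq d]

/-- The ENSTROPHY `ℰ(v) = ½ ∫_{T^d} |∇v|² = ½‖∇v‖₂²` of a velocity field on the unit torus
(Ayala–Protas 2017, eqs. (2.3)–(2.4): `ℰ = ½∫|∇×v|²` and `∫|∇×v|² = ∫|∇v|²` for periodic
divergence-free `v`; Lu–Doering 2008, §1). Half the tree's `Torus.gradNormSq`.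
[cite: AyalaProtas2017, eqs. (2.3)–(2.4)] -/
def torusEnstrophy (v : UnitAddTorus d → EuclideanSpace ℝ d) : ℝ :=
  2⁻¹ * Torus.gradNormSq v

/-- Enstrophy is nonnegative. [folklore] -/
theorem torusEnstrophy_nonneg (v : UnitAddTorus d → EuclideanSpace ℝ d) : 0 ≤ torusEnstrophy v :=
  mul_nonneg (by norm_num) (Torus.gradNormSq_nonneg v)

/-- `‖∇v‖₂² = 2ℰ(v)`. [folklore] -/
theorem gradNormSq_eq_two_mul_torusEnstrophy (v : UnitAddTorus d → EuclideanSpace ℝ d) :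
    Torus.gradNormSq v = 2 * torusEnstrophy v := by
  unfold torusEnstrophy
  ring

/-- **Lu–Doering instantaneous enstrophy estimate (named fact).** On the unit 3-torus
(`Fintype.card d = 3`), for every `ν > 0` and every classical solution `(u, p)` of the UNFORCED
Navier–Stokes system on a time interval `[a, b]`, `a < b`, with zero spatial mean at all times, the
enstrophy `ℰ(t) = ½‖∇u(t)‖₂²` satisfies
`dℰ/dt ≤ (27/(8π⁴ν³)) ℰ³`
in the sense that every one-sided derivative value `R` of `t ↦ ℰ(u(t))` within `[a, b]` obeys
`R ≤ luDoeringConst ν · ℰ(u(t))³` (Lu–Doering 2008, the main analytic estimate, shown there to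
be sharp up to the numerical prefactor; Ayala–Protas 2017, eq. (2.7); Kang–Yun–Protas 2020, §2).
The derivative exists (`Torus.IsClassicalNSSolutionOn.hasDerivWithinAt_half_gradNormSq`), so the
statement is not vacuous. [cite: LuDoering2008, main estimate (Ayala–Protas 2017 eq. (2.7))] -/
def LuDoering2008_enstrophyRate_le : Prop :=
  Fintype.card d = 3 → ∀ {ν : ℝ}, 0 < ν → ∀ {a b : ℝ}, a < b →
    ∀ {u : ℝ → UnitAddTorus d → EuclideanSpace ℝ d} {p : ℝ → UnitAddTorus d → ℝ},
      Torus.IsClassicalNSSolutionOn (Icc a b) ν 0 u p →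
      (∀ t ∈ Icc a b, Torus.HasZeroMean (u t)) →
      ∀ t ∈ Icc a b, ∀ R : ℝ,
        HasDerivWithinAt (fun s => torusEnstrophy (u s)) R (Icc a b) t →
          R ≤ luDoeringConst ν * torusEnstrophy (u t) ^ 3

/-- **Finite-time enstrophy bound (Ayala–Protas 2017, eq. (2.8)), from the Lu–Doering estimate.**
Under `LuDoering2008_enstrophyRate_le`: for a zero-mean classical solution of unforced
Navier–Stokes on `T³ × [a, b]` with positive enstrophy, and `t ∈ [a, b]` before the blow-up time of
the bound, `2 C_LD ℰ(a)² (t − a) < 1` (i.e. `t − a < 4π⁴ν³/(27ℰ(a)²)`),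
`ℰ(u(t)) ≤ ℰ(u(a)) / √(1 − (27/(4π⁴ν³)) ℰ(u(a))² (t − a))`. [cite: AyalaProtas2017, eq. (2.8)] -/
theorem torusEnstrophy_le_luDoeringMajorant (hLD : LuDoering2008_enstrophyRate_le (d := d))
    (hd : Fintype.card d = 3) {ν a b : ℝ} (hν : 0 < ν) (hab : a < b)
    {u : ℝ → UnitAddTorus d → EuclideanSpace ℝ d} {p : ℝ → UnitAddTorus d → ℝ}
    (h : Torus.IsClassicalNSSolutionOn (Icc a b) ν 0 u p)
    (hmean : ∀ t ∈ Icc a b, Torus.HasZeroMean (u t))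
    (hpos : ∀ t ∈ Icc a b, 0 < torusEnstrophy (u t)) {t : ℝ} (ht : t ∈ Icc a b)
    (hsmall : 2 * luDoeringConst ν * torusEnstrophy (u a) ^ 2 * (t - a) < 1) :
    torusEnstrophy (u t) ≤ luDoeringMajorant ν (torusEnstrophy (u a)) (t - a) := by
  set F : ℝ → ℝ := fun s => -ν * (∫ x, ‖Torus.laplacian (u s) x‖ ^ 2) +
      ∫ x, ⟪Torus.convect (u s) (u s) x - (0 : ℝ → UnitAddTorus d → EuclideanSpace ℝ d) s x,
        Torus.laplacian (u s) x⟫ with hF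
  have hder : ∀ s ∈ Icc a b,
      HasDerivWithinAt (fun r => torusEnstrophy (u r)) (F s) (Icc a b) s :=
    fun s hs => h.hasDerivWithinAt_half_gradNormSq hab hs
  have hle : ∀ s ∈ Icc a b, F s ≤ luDoeringConst ν * torusEnstrophy (u s) ^ 3 :=
    fun s hs => hLD hd hν hab h hmean s hs (F s) (hder s hs)
  exact le_div_sqrt_of_hasDerivWithinAt_le_cube hab hder hpos hle ht hsmall

/-- **Energy–enstrophy inequality (Ayala–Protas 2017, eq. (2.10)), from the Lu–Doering estimate
and the energy identity `dK/dt = −2νℰ`.** Under `LuDoering2008_enstrophyRate_le`: along a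
zero-mean classical solution of unforced Navier–Stokes on `T³ × [a, b]` with positive enstrophy,
`1/ℰ(u(a)) − 1/ℰ(u(t)) ≤ (C_LD/(2ν)) (K(u(a)) − K(u(t)))`, and `C_LD/(2ν) = 27/(2πν)⁴`
(`luDoeringConst_div_two_nu`). [cite: AyalaProtas2017, eq. (2.10)] -/
theorem inv_torusEnstrophy_sub_inv_le (hLD : LuDoering2008_enstrophyRate_le (d := d))
    (hd : Fintype.card d = 3) {ν a b : ℝ} (hν : 0 < ν) (hab : a < b)
    {u : ℝ → UnitAddTorus d → EuclideanSpace ℝ d} {p : ℝ → UnitAddTorus d → ℝ}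
    (h : Torus.IsClassicalNSSolutionOn (Icc a b) ν 0 u p)
    (hmean : ∀ t ∈ Icc a b, Torus.HasZeroMean (u t))
    (hpos : ∀ t ∈ Icc a b, 0 < torusEnstrophy (u t)) {t : ℝ} (ht : t ∈ Icc a b) :
    (torusEnstrophy (u a))⁻¹ - (torusEnstrophy (u t))⁻¹ ≤
      luDoeringConst ν / (2 * ν) * (Torus.kineticEnergy (u a) - Torus.kineticEnergy (u t)) := by
  have ha : a ∈ Icc a b := left_mem_Icc.2 hab.le
  set C : ℝ := luDoeringConst ν with hC
  have hC0 : 0 < C := luDoeringConst_pos hν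
  set c : ℝ := C / (2 * ν) with hc
  -- derivatives of enstrophy and energy within `[a, b]`
  set F : ℝ → ℝ := fun s => -ν * (∫ x, ‖Torus.laplacian (u s) x‖ ^ 2) +
      ∫ x, ⟪Torus.convect (u s) (u s) x - (0 : ℝ → UnitAddTorus d → EuclideanSpace ℝ d) s x,
        Torus.laplacian (u s) x⟫ with hF
  have hder : ∀ s ∈ Icc a b,
      HasDerivWithinAt (fun r => torusEnstrophy (u r)) (F s) (Icc a b) s :=
    fun s hs => h.hasDerivWithinAt_half_gradNormSq hab hs
  have hle : ∀ s ∈ Icc a b, F s ≤ C * torusEnstrophy (u s) ^ 3 :=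
    fun s hs => hLD hd hν hab h hmean s hs (F s) (hder s hs)
  have hK : ∀ s ∈ Icc a b, HasDerivWithinAt (fun r => Torus.kineticEnergy (u r))
      (-ν * Torus.gradNormSq (u s)) (Icc a b) s := by
    intro s hs
    have hb := Torus.IsClassicalNSSolutionOn.energy_balance_holds h (convex_Icc a b) hs
    simpa using hb
  -- `G = 1/ℰ − c K` is nondecreasing
  set G : ℝ → ℝ := fun s => (torusEnstrophy (u s))⁻¹ - c * Torus.kineticEnergy (u s) with hG
  have hG' : ∀ s ∈ Icc a b, HasDerivWithinAt G
      (-(F s) / torusEnstrophy (u s) ^ 2 - c * (-ν * Torus.gradNormSq (u s))) (Icc a b) s :=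
    fun s hs => ((hder s hs).inv (hpos s hs).ne').sub ((hK s hs).const_mul c)
  have hmono : MonotoneOn G (Icc a b) := by
    refine monotoneOn_of_hasDerivWithinAt_nonneg (convex_Icc a b)
      (fun s hs => (hG' s hs).continuousWithinAt)
      (fun s hs => (hG' s (interior_subset hs)).mono interior_subset) fun s hs => ?_
    rw [interior_Icc] at hs
    have hs' : s ∈ Icc a b := Ioo_subset_Icc_self hs
    have hEs : 0 < torusEnstrophy (u s) := hpos s hs'
    have h1 : F s / torusEnstrophy (u s) ^ 2 ≤ C * torusEnstrophy (u s) := by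
      rw [div_le_iff₀ (by positivity)]
      nlinarith [hle s hs']
    have h2 : c * (-ν * Torus.gradNormSq (u s)) = -(C * torusEnstrophy (u s)) := by
      rw [gradNormSq_eq_two_mul_torusEnstrophy, hc]
      field_simp
    have h3 : -(F s) / torusEnstrophy (u s) ^ 2 = -(F s / torusEnstrophy (u s) ^ 2) := neg_div _ _
    rw [h2, h3]
    linarith
  have hcmp : G a ≤ G t := hmono ha ht ht.1
  simp only [hG] at hcmp
  linarith

/-- **Uniform enstrophy bound for small data (Ayala–Protas 2017, eqs. (2.11)–(2.12), after
Lu–Doering 2008), from the Lu–Doering estimate.** Under `LuDoering2008_enstrophyRate_le`: along a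
zero-mean classical solution of unforced Navier–Stokes on `T³ × [a, b]` with positive enstrophy, if
`σ := (C_LD/(2ν)) K(u(a)) ℰ(u(a)) = 27 K(u(a))ℰ(u(a))/(2πν)⁴ < 1` — equivalently
`K(u(a))ℰ(u(a)) < (2πν)⁴/27 = luDoeringSmallDataThreshold ν` — then for every `t ∈ [a, b]`,
`ℰ(u(t)) ≤ ℰ(u(a)) / (1 − σ)`. [cite: AyalaProtas2017, eqs. (2.11)–(2.12)] -/
theorem torusEnstrophy_le_of_small (hLD : LuDoering2008_enstrophyRate_le (d := d))
    (hd : Fintype.card d = 3) {ν a b : ℝ} (hν : 0 < ν) (hab : a < b)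
    {u : ℝ → UnitAddTorus d → EuclideanSpace ℝ d} {p : ℝ → UnitAddTorus d → ℝ}
    (h : Torus.IsClassicalNSSolutionOn (Icc a b) ν 0 u p)
    (hmean : ∀ t ∈ Icc a b, Torus.HasZeroMean (u t))
    (hpos : ∀ t ∈ Icc a b, 0 < torusEnstrophy (u t))
    (hσ : luDoeringConst ν / (2 * ν) * Torus.kineticEnergy (u a) * torusEnstrophy (u a) < 1)
    {t : ℝ} (ht : t ∈ Icc a b) :
    torusEnstrophy (u t) ≤ torusEnstrophy (u a) /
      (1 - luDoeringConst ν / (2 * ν) * Torus.kineticEnergy (u a) * torusEnstrophy (u a)) := by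
  have ha : a ∈ Icc a b := left_mem_Icc.2 hab.le
  have h10 := inv_torusEnstrophy_sub_inv_le hLD hd hν hab h hmean hpos ht
  set c : ℝ := luDoeringConst ν / (2 * ν) with hc
  have hc0 : 0 ≤ c := by
    rw [hc]
    exact div_nonneg (luDoeringConst_pos hν).le (by positivity)
  set Ea : ℝ := torusEnstrophy (u a) with hEa
  set Et : ℝ := torusEnstrophy (u t) with hEt
  set Ka : ℝ := Torus.kineticEnergy (u a) with hKa
  have hEa0 : 0 < Ea := hpos a ha
  have hEt0 : 0 < Et := hpos t ht
  have hKt : 0 ≤ Torus.kineticEnergy (u t) := Torus.kineticEnergy_nonneg _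
  -- drop `K(t) ≥ 0`: `1/ℰ(a) − 1/ℰ(t) ≤ c K(a)`
  have h1 : Ea⁻¹ - Et⁻¹ ≤ c * Ka := by
    have : c * (Ka - Torus.kineticEnergy (u t)) ≤ c * Ka := by nlinarith
    exact h10.trans this
  -- multiply by `ℰ(a) ℰ(t) > 0`
  have h2 : Et * (1 - c * Ka * Ea) ≤ Ea := by
    have h3 := mul_le_mul_of_nonneg_right h1 (le_of_lt (mul_pos hEa0 hEt0))
    have e1 : (Ea⁻¹ - Et⁻¹) * (Ea * Et) = Et - Ea := by
      field_simp
    rw [e1] at h3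
    nlinarith [h3]
  have hD : 0 < 1 - c * Ka * Ea := by linarith
  rw [le_div_iff₀ hD]
  exact h2

end Torus

end Literature.Analysis.FluidPDE

end
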